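import Summits.QuantumFields.YangMills.Theorems.BalabanUVNodesN14ConvexFibreCauchy

/-!
# BalabanUVNodes ∕ node N14 = NE1′ — THE ENGINE AT THE OBSERVABLES OF RECORD IS IDLE (LENS decomp v6, F1 ∕ ROW CS-X): a FIBRE-BLIND observable sees only the
# block marginal, so on the template the binder is the pure LAW defect, `η K = B₀(e^{2δ K} − 1)`, and the T⁴ Cauchy property follows from `Σ δ K < ∞` ALONE —
# with no convexity, no fibre gradient, no observable defect; the surviving letter `δ K` is keyed on the UNIT LATTICE (F2)

Cell `pub-ymgap`, HUMAN RULING D-0062 (Track A at full width), seat `pub-ymgap-dag-n14-c` (R134 ACCELERATION, strategy s1), generation 5;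
route `Summits/QuantumFields/YangMills/Theses/BalabanUVNodes.lean` rev 16∕17 (cluster K3‴ `SpineGivenEndpointR13` = stmt-QuantumFields-19912,
`--supports … --as helper`); venue ruling R424 (`YangMills/Theorems`, namespace `YMDAG.N14.ConvexFibreAtRecord`).  ADDITIVE — imports K (`…ConvexFibreCauchy`,
hence J's law-defect lemma and the gaps-ne1 `Spine/NE1p/DressedMGFForm` calculus); THEOREMS ONLY (0 `def`), modifies nothing.

SOURCE OF RECORD.  LENS decomp v6 (planner seat `ym-lens-BalabanUVNodes-decomp` g6, memo `LENS-decomp.md` v6 b0cbfd2d6b6e77ce, farm-checked sketch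
`LensDecompNE7v6.sketch.lean` 2f0c09ef6eee62ec, pub-ymgap INBOX 2026-08-27T04:10Z, ROW CS-X → this seat; the lens files nothing — §1 below LIFTS its sketch §1
verbatim WITH CREDIT, as the row asks).  FINDING F1 «ENGINE IDLE AT THE RECORD»: at the observables of record (`T4RunLadder`: `UnitFactorisation.fac : obs K o =
W_o ∘ A_K`, `NestedFactorisation.nest : A_{K+1} = A_K ∘ B_K`) run `K+1`'s averaged loop variable factors through run `K+1`'s FIRST averaging `B_K` — the base of the
engine's fibre (`ν K ⊗ₘ κ K` with `B_K ∘ e_K = Prod.fst`) — so in the template files G–L the observable `G K = F (K+1) ∘ e K` IS `F K ∘ Prod.fst`: FIBRE-BLIND.  FINDING F2 «KEY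
FORK»: the law defect cannot be keyed as a sup-tilt `|g| ≤ δ K` on run `K`'s FINEST field space (the first-step effective-action correction is EXTENSIVE,
[Balaban1987RG1] (1.7) p.261, (1.18) p.263: `sup|g| ≳ E₀·#D_j`); keyed on the UNIT LATTICE `X` through `(A K)_*` it is the class-level, mod-constants matching of the
two runs' pushed-forward class pieces — the lens's SHAPE_cl, NE7 proper (ROW CD-CORE, dag-n19-c; ne1 gen 2 `DressedMGFFormUnitLattice.tiltedMeanMatching_iff_map`).

WHAT THIS IS.
* §1 [folklore; LENS v6 sketch §1, lifted with credit] `integral_comp_fst_compProd`, **`tiltedMean_comp_fst_compProd`** (`tiltedMean (F ∘ fst) (ν ⊗ₘ κ) s = tiltedMean F ν s`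
  for a Markov fibre), `fibreAvg_comp_fst`, **`tiltedMeanMatching_compProd_iff`** (on a fibre-blind tower `TiltedMeanMatching` IS the same-space, same-observable
  matching of run A's class laws against run B's marginals), `tiltedMeanMatching_consistentTower_fibreBlind` ((OBS′): `η = 0` on the exactly consistent tower; LENS control §7).
* §2 [folklore ∘ J §1] THE SPECIALISATION OF K: **`abs_tiltedMean_step_le_of_fibreBlind`** — K's one step with `F₁ ∘ e = F₀ ∘ fst`: NO schema, NO gradient, NO observable
  defect, ANY Markov fibre: `|tiltedMean F₁ ((ν ⊗ₘ κ).map e) s − tiltedMean F₀ (ν.tilted g) s| ≤ B₀·(e^{2δ} − 1)` (`|g| ≤ δ`); **`matchingModConstants_of_fibreBlindTower`**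
  (`T4CauchySum.MatchingModConstants vol l₀ (fun K => l₀∕vol·B₀(e^{2δ K} − 1)) Z`), **`cauchySeq_genFun_of_fibreBlindTower`** (`Σ δ K < ∞` ALONE ⇒ Cauchy generating
  functions) — K∕L's letters `C`, `L K`, `ε K` are absent: at the record the (I)-binder is the law defect and nothing else.
* §3 [folklore ∘ K §1 `tiltedMean_map`; ne1 gen 2 `tiltedMean_comp_eq` is the tree's prior statement of the same identity] THE X-KEYING OF THE SURVIVING LETTER:
  `tiltedMean_obs_eq_map` (`tiltedMean (φ ∘ A) μ s = tiltedMean φ (μ.map A) s`), **`abs_tiltedMean_obs_sub_le_of_tilt_atUnit`** — if the two runs' laws PUSHED TO THE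
  UNIT LATTICE differ by a bounded tilt up to a constant factor (`μB.map A' = c • (μA.map A).tilted g`, `|g| ≤ r`: the lens's SHAPE statement for ONE class, `c` the
  mod-constant), then `|tiltedMean (φ ∘ A') μB s − tiltedMean (φ ∘ A) μA s| ≤ B₀(e^{2r} − 1)` — the form in which `δ K` is satisfiable (F2); the class-indexed producer
  from SHAPE_cl is ROW CD-CORE's `N19ClassSandwichRoad.tiltedMeanMatching_of_shapeDensity` (dag-n19-c, p496221 ✓ — same space, density form), not restated here.

WHAT THIS IS NOT.  Everything here is PROVED (0 `sorry`, 0 named facts).  It RETRACTS nothing of files A–L (template mathematics, correct as stated) but RECORDS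
their standing at the record: with fibre-blind observables the convex-fibre engine's second-order mechanism is not load-bearing for N14's binder; the binder is
NE7-type law matching on the unit lattice (SHAPE_cl), NOT PRINTED in d = 4, produced by nobody.  Nothing of Bałaban's instantiated; N14 NOT discharged;
count-neutral.  One finite four-torus programme at fixed ε; NOT ℝ⁴, NOT OS, NOT a mass gap, NOT Clay.
-/

noncomputable section

namespace YMDAG.N14.ConvexFibreAtRecord

open MeasureTheory ProbabilityTheory Set Filter Topology
open scoped ENNReal NNReal
open Literature.MathematicalPhysics.QuantumFieldTheory.Balaban1983to89.T4CauchySum (MatchingModConstants genFun cauchySeq_genFun)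
open Summit.QuantumFields.BalabanUV.T4Continuum.NE1p.DressedMGFForm (tiltedMean TiltedMeanMatching matchingModConstants_of_tiltedMeans)
open YMDAG.N14.ConvexFibreMatching (tiltedMean_smul_measure)
open YMDAG.N14.ConvexFibreConsistency (abs_tiltedMean_tilted_sub_le)
open YMDAG.N14.ConvexFibreCauchy (tiltedMean_map summable_exp_sub_one)

/-! ## §1 ENGINE IDLE: a fibre-blind observable sees only the base law (LENS decomp v6 sketch §1, lifted with credit) -/
section EngineIdle

variable {Ω E : Type*} [MeasurableSpace Ω] [MeasurableSpace E] {ν : Measure Ω} [SFinite ν] {κ : Kernel Ω E} [IsMarkovKernel κ] {F : Ω → ℝ}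

/-- A base-only integrand integrates over the base (Markov fibre). [folklore; LENS decomp v6 sketch §1] -/
theorem integral_comp_fst_compProd {h : Ω → ℝ} (hh : Measurable h) : ∫ p, h p.1 ∂(ν ⊗ₘ κ) = ∫ x, h x ∂ν := by
  have hfst : (ν ⊗ₘ κ).map Prod.fst = ν := Measure.fst_compProd ν κ
  have hh' : AEStronglyMeasurable h ((ν ⊗ₘ κ).map Prod.fst) := by
    rw [hfst]; exact hh.aestronglyMeasurable
  rw [← integral_map measurable_fst.aemeasurable hh', hfst]

/-- **ENGINE IDLE** [folklore; LENS decomp v6 sketch §1, F1].  The source-tilted mean of a FIBRE-BLIND observable under `ν ⊗ₘ κ` is its tilted mean under `ν`: the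
fibre integrates out of numerator and denominator alike (the fibre form, for this seat's template, of the tree's unit-lattice
`DressedMGFFormUnitLattice.tiltedMean_comp_eq`). -/
theorem tiltedMean_comp_fst_compProd (hF : Measurable F) (s : ℝ) :
    tiltedMean (fun p : Ω × E => F p.1) (ν ⊗ₘ κ) s = tiltedMean F ν s := by
  simp only [tiltedMean, integral_tilted]
  have e1 : ∫ p, Real.exp (s * F p.1) ∂(ν ⊗ₘ κ) = ∫ x, Real.exp (s * F x) ∂ν :=
    integral_comp_fst_compProd (ν := ν) (κ := κ) (h := fun x => Real.exp (s * F x)) (by fun_prop)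
  rw [e1]
  exact integral_comp_fst_compProd (ν := ν) (κ := κ)
    (h := fun x => (Real.exp (s * F x) / ∫ y, Real.exp (s * F y) ∂ν) • F x) (by fun_prop)

/-- … and its fibre average is itself (so the template's run-A observable `Ḡ` IS `F`: the observable defect `ε` of file K is `0`). [folklore; LENS decomp v6 sketch §1] -/
theorem fibreAvg_comp_fst (F : Ω → ℝ) (b : Ω) : ∫ x, (fun p : Ω × E => F p.1) (b, x) ∂(κ b) = F b := by
  simp

end EngineIdle

section Binder

variable {ι : Type*} [DecidableEq ι] {Ω E : ℕ → Type*} [∀ K, MeasurableSpace (Ω K)] [∀ K, MeasurableSpace (E K)]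
  {l₀ : ℝ} {T : ℕ → Finset ι} {Bad : ℕ → ℝ → Finset ι} {F : ∀ K, Ω K → ℝ} {ν ν₁ : ∀ K, ι → Measure (Ω K)}
  {κ : ∀ K, Kernel (Ω K) (E K)} {η : ℕ → ℝ}

/-- **THE (I)-BINDER ON A FIBRE-BLIND TOWER IS THE PURE DEFECT** [bookkeeping ∘ §1; LENS decomp v6 sketch §1]: with run B `= ν K τ ⊗ₘ κ K` read through a fibre-blind
observable `F K ∘ fst` and run A `= ν₁ K τ` read through `F K`, `TiltedMeanMatching` is LITERALLY the same-space, same-observable matching of `ν₁ K τ` against the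
marginal `ν K τ` — the convex-fibre engine contributes nothing. -/
theorem tiltedMeanMatching_compProd_iff (hν : ∀ K τ, SFinite (ν K τ)) (hκ : ∀ K, IsMarkovKernel (κ K)) (hF : ∀ K, Measurable (F K)) :
    TiltedMeanMatching l₀ T Bad F ν₁ (fun K (p : Ω K × E K) => F K p.1) (fun K τ => ν K τ ⊗ₘ κ K) η ↔
      TiltedMeanMatching l₀ T Bad F ν₁ F ν η := by
  have h : ∀ K τ s, tiltedMean (fun p : Ω K × E K => F K p.1) (ν K τ ⊗ₘ κ K) s = tiltedMean (F K) (ν K τ) s := by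
    intro K τ s
    haveI := hν K τ; haveI := hκ K
    exact tiltedMean_comp_fst_compProd (hF K) s
  simp only [TiltedMeanMatching, h]

/-- **(OBS′) ON THE EXACTLY CONSISTENT TOWER A FIBRE-BLIND OBSERVABLE MATCHES WITH `η = 0`** [folklore; LENS control g4 sketch §7
`tiltedMeanMatching_consistentTower_fibreBlind`, here as a one-line corollary of the previous lemma]: run A `= ν K τ` (the exact marginals), run B `= ν K τ ⊗ₘ κ K`
read through `F K ∘ fst` ⇒ `TiltedMeanMatching … F ν (F ∘ fst) (ν ⊗ₘ κ) 0` — every one-step fibre engine multiplies a vanishing quantity there. -/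
theorem tiltedMeanMatching_consistentTower_fibreBlind (hν : ∀ K τ, SFinite (ν K τ)) (hκ : ∀ K, IsMarkovKernel (κ K)) (hF : ∀ K, Measurable (F K)) :
    TiltedMeanMatching l₀ T Bad F ν (fun K (p : Ω K × E K) => F K p.1) (fun K τ => ν K τ ⊗ₘ κ K) fun _ => 0 := by
  rw [tiltedMeanMatching_compProd_iff hν hκ hF]
  intro K t _ τ _ s _
  rw [sub_self, abs_zero]

end Binder

/-! ## §2 The specialisation of file K at fibre-blind observables: the law defect alone -/
section Step

variable {B E Ω₁ : Type*} [MeasurableSpace B] [MeasurableSpace E] [MeasurableSpace Ω₁] {ν : Measure B} [IsProbabilityMeasure ν]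
  {κ : Kernel B E} [IsMarkovKernel κ] {g F₀ : B → ℝ} {e : B × E → Ω₁} {F₁ : Ω₁ → ℝ} {B₀ δ : ℝ}

/-- **ONE STEP AT A FIBRE-BLIND OBSERVABLE** [folklore ∘ §1 + J §1 `abs_tiltedMean_tilted_sub_le`].  Run `K+1` `= (ν ⊗ₘ κ).map e` (ANY Markov fibre `κ`, ANY
measurable re-coordinatisation `e`) read by `F₁` with `F₁ ∘ e = F₀ ∘ fst`; run `K` `= ν.tilted g` (`|g| ≤ δ`) read by `F₀` (measurable, `|F₀| ≤ B₀`).  Then for EVERY `s`: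
`|tiltedMean F₁ ((ν ⊗ₘ κ).map e) s − tiltedMean F₀ (ν.tilted g) s| ≤ B₀·(e^{2δ} − 1)` — K's `abs_tiltedMean_step_le` with the schema, the gradient `L` and the observable
defect `ε` GONE. -/
theorem abs_tiltedMean_step_le_of_fibreBlind (he : Measurable e) (hF₁m : Measurable F₁) (hF₁ : ∀ p, F₁ (e p) = F₀ p.1)
    (hF₀m : Measurable F₀) (hF₀b : ∀ b, |F₀ b| ≤ B₀) (hgm : Measurable g) (hgb : ∀ b, |g b| ≤ δ) (s : ℝ) :
    |tiltedMean F₁ ((ν ⊗ₘ κ).map e) s - tiltedMean F₀ (ν.tilted g) s| ≤ B₀ * (Real.exp (2 * δ) - 1) := by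
  have hcomp : F₁ ∘ e = fun p : B × E => F₀ p.1 := funext hF₁
  rw [tiltedMean_map he hF₁m, hcomp, tiltedMean_comp_fst_compProd (ν := ν) (κ := κ) hF₀m, abs_sub_comm]
  exact abs_tiltedMean_tilted_sub_le (μ := ν) hgm hgb hF₀m hF₀b s

end Step

section Tower

variable {Ω E : ℕ → Type*} [∀ K, MeasurableSpace (Ω K)] [∀ K, MeasurableSpace (E K)] {l₀ B₀ vol : ℝ} {δ : ℕ → ℝ}
  {μ ν : ∀ K, Measure (Ω K)} {κ : ∀ K, Kernel (Ω K) (E K)} {g : ∀ K, Ω K → ℝ} {e : ∀ K, Ω K × E K → Ω (K + 1)}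
  {F : ∀ K, Ω K → ℝ} {Z : ℕ → ℝ → ℝ}

/-- **N19's SHAPE ON THE FIBRE-BLIND TOWER: THE LAW DEFECT ALONE** [folklore ∘ §2 + gaps-ne1's `matchingModConstants_of_tiltedMeans`].  Tower: exact marginals `ν K`
(probability), run laws `μ K = (ν K).tilted (g K)` (`|g K| ≤ δ K`, `δ K ≥ 0`), `μ (K+1) = (ν K ⊗ₘ κ K).map (e K)` with ANY Markov fibres; observables `F K`
(measurable, `|F K| ≤ B₀`) with `F (K+1) ∘ e K = F K ∘ fst` (fibre-blind — the observables of record, `T4RunLadder`).  Then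
`MatchingModConstants vol l₀ (fun K => l₀∕vol·B₀(e^{2δ K} − 1)) Z` for `Z K t = mgf (F K) (μ K) t`, `vol > 0`. -/
theorem matchingModConstants_of_fibreBlindTower (hvol : 0 < vol) (hν : ∀ K, IsProbabilityMeasure (ν K))
    (hκM : ∀ K, IsMarkovKernel (κ K)) (hgm : ∀ K, Measurable (g K)) (hgb : ∀ K b, |g K b| ≤ δ K) (he : ∀ K, Measurable (e K))
    (hFm : ∀ K, Measurable (F K)) (hFb : ∀ K x, |F K x| ≤ B₀) (hFe : ∀ K p, F (K + 1) (e K p) = F K p.1)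
    (hA : ∀ K, μ K = (ν K).tilted (g K)) (hB : ∀ K, μ (K + 1) = ((ν K) ⊗ₘ κ K).map (e K)) (hZ : ∀ K t, Z K t = mgf (F K) (μ K) t) :
    MatchingModConstants vol l₀ (fun K => l₀ / vol * (B₀ * (Real.exp (2 * δ K) - 1))) Z := by
  haveI : ∀ K, IsFiniteMeasure (μ K) := fun K => by
    haveI := hν K
    have hgi : Integrable (fun b => Real.exp (g K b)) (ν K) := by
      have := Literature.Probability.Moments.integrable_exp_mul_of_abs_le_const (ν K) (hgm K) (hgb K) 1; simpa using this
    rw [hA K]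
    haveI := isProbabilityMeasure_tilted hgi
    infer_instance
  refine matchingModConstants_of_tiltedMeans (μ := μ) (η := fun K => B₀ * (Real.exp (2 * δ K) - 1)) hFm hFb hZ (fun K s _ => ?_) (fun K => ?_)
  · haveI := hν K
    haveI := hκM K
    rw [hB K, hA K]
    exact abs_tiltedMean_step_le_of_fibreBlind (ν := ν K) (κ := κ K) (he K) (hFm (K + 1)) (hFe K) (hFm K) (hFb K) (hgm K) (hgb K) s
  · exact le_of_eq (by field_simp)

/-- **THE T⁴ CAUCHY PROPERTY AT FIBRE-BLIND OBSERVABLES ⇐ `Σ δ K < ∞` ALONE** [folklore ∘ the previous theorem + `T4CauchySum.cauchySeq_genFun`]: on the template of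
files K∕L read through the observables of record, every generating function `K ↦ genFun Z K t`, `|t| ≤ l₀`, is Cauchy as soon as the law defects are summable —
no convexity, no fibre gradient, no observable defect.  (Where `Σ δ K < ∞` can come from is F2: NOT as a sup-tilt on the finest space — §3 and `…N14LawChannel`.) -/
theorem cauchySeq_genFun_of_fibreBlindTower (hvol : 0 < vol) (hl₀ : 0 ≤ l₀) (hν : ∀ K, IsProbabilityMeasure (ν K))
    (hκM : ∀ K, IsMarkovKernel (κ K)) (hgm : ∀ K, Measurable (g K)) (hδ0 : ∀ K, 0 ≤ δ K) (hgb : ∀ K b, |g K b| ≤ δ K) (hδ : Summable δ)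
    (he : ∀ K, Measurable (e K)) (hFm : ∀ K, Measurable (F K)) (hFb : ∀ K x, |F K x| ≤ B₀) (hFe : ∀ K p, F (K + 1) (e K p) = F K p.1)
    (hA : ∀ K, μ K = (ν K).tilted (g K)) (hB : ∀ K, μ (K + 1) = ((ν K) ⊗ₘ κ K).map (e K)) (hZ : ∀ K t, Z K t = mgf (F K) (μ K) t)
    {t : ℝ} (ht : |t| ≤ l₀) : CauchySeq fun K => genFun Z K t := by
  refine cauchySeq_genFun (matchingModConstants_of_fibreBlindTower hvol hν hκM hgm hgb he hFm hFb hFe hA hB hZ) hl₀ ?_ ht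
  exact ((summable_exp_sub_one (a := fun K => 2 * δ K) (hδ.mul_left 2) fun K => by linarith [hδ0 K]).mul_left B₀).mul_left _

end Tower

/-! ## §3 The surviving letter keyed on the unit lattice (F2): a bounded tilt of the PUSHED-FORWARD laws -/
section AtUnit

variable {ΩA ΩB X : Type*} [MeasurableSpace ΩA] [MeasurableSpace ΩB] [MeasurableSpace X]
  {μA : Measure ΩA} {μB : Measure ΩB} {A : ΩA → X} {A' : ΩB → X} {φ g : X → ℝ} {B₀ r : ℝ}

/-- The tilted mean of an observable READ THROUGH A MAP is the tilted mean of the observable under the pushed-forward law [folklore ∘ K §1 `tiltedMean_map`; the tree's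
prior statement is ne1 gen 2 `DressedMGFFormUnitLattice.tiltedMean_comp_eq`]. -/
theorem tiltedMean_obs_eq_map (hA : Measurable A) (hφ : Measurable φ) (s : ℝ) : tiltedMean (φ ∘ A) μA s = tiltedMean φ (μA.map A) s :=
  (tiltedMean_map hA hφ s).symm

/-- **THE LAW DEFECT KEYED ON THE UNIT LATTICE** [folklore ∘ J §1; F2].  Two runs on their own field spaces `ΩA`, `ΩB`, read through measurable maps `A`, `A'` to the unit
lattice `X` by ONE bounded measurable observable `φ` (`|φ| ≤ B₀`); if the pushed-forward laws differ by a bounded tilt up to a positive constant —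
`μB.map A' = c • (μA.map A).tilted g`, `|g| ≤ r`, `μA.map A` a probability law (one class of the lens's SHAPE_cl, `c` its mod-constant) — then for EVERY tilt `s`:
`|tiltedMean (φ ∘ A') μB s − tiltedMean (φ ∘ A) μA s| ≤ B₀·(e^{2r} − 1)`.  This is the shape in which the surviving letter of §2 is satisfiable at the record; its
class-indexed, same-space, density-form producer from SHAPE_cl is dag-n19-c's `N19ClassSandwichRoad.tiltedMeanMatching_of_shapeDensity` (p496221 ✓), not restated. -/
theorem abs_tiltedMean_obs_sub_le_of_tilt_atUnit [IsProbabilityMeasure (μA.map A)] (hA : Measurable A) (hA' : Measurable A') (hφm : Measurable φ)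
    (hφb : ∀ x, |φ x| ≤ B₀) (hgm : Measurable g) (hgb : ∀ x, |g x| ≤ r) {c : ℝ≥0∞} (hc0 : c ≠ 0) (hcT : c ≠ ∞)
    (hshape : μB.map A' = c • (μA.map A).tilted g) (s : ℝ) :
    |tiltedMean (φ ∘ A') μB s - tiltedMean (φ ∘ A) μA s| ≤ B₀ * (Real.exp (2 * r) - 1) := by
  rw [tiltedMean_obs_eq_map hA' hφm, tiltedMean_obs_eq_map hA hφm, hshape, tiltedMean_smul_measure _ _ hc0 hcT]
  exact abs_tiltedMean_tilted_sub_le (μ := μA.map A) hgm hgb hφm hφb s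

end AtUnit

end YMDAG.N14.ConvexFibreAtRecord

end
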